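import Mathlib

/-!
# RootDecomp1E — structure of the E-stable sector (lens-2 g7, round 7 «MultiplicationType»)

Support for the crux `Summit.Schanuel.Schanuel.Theses.RootDecomp1E.EStableDefectOne` (stmt-Schanuel-31409).
An E-STABLE free span `V = span_ℚ z` (some irrational algebraic `β` with `β·V ⊆ V`) is a vector space over the
number field `K = ℚ(β)`; hence

* `finrank_eq_degree_mul` / `degree_dvd` : `n = [ℚ(β):ℚ] · dim_K V`, so `deg β ∣ n`;
* `eStable_structure` : `V` has a ℚ-basis `(β^k · u_j)_{k < deg β, j < n/deg β}` with the `u_j ∈ V` —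
  the E-stable sector of length `n` is the disjoint union over `d ∣ n, d ≥ 2` of the cells
  «`K`-spaces of `K`-dimension `n/d`, `[K:ℚ] = d`» (at `n = 4`: quadratic BIPLANES `(u, βu, v, βv)` or quartic
  E-LINES `(λ, βλ, β²λ, β³λ)`; at `n = 6`: `d ∈ {2,3,6}`);
* `eStable_prime_isLine` : for PRIME `n` the E-stable sector is exactly the E-LINE cell `ℚ(β)·λ`, `[ℚ(β):ℚ] = n`
  (so, with the grid-blindness certificate of the leaves, for primes `n ≥ 5` the whole sector is invisible to the
  Conjecture-2.3 numerology).

Mathlib only (tower law `Module.finrank_mul_finrank`, `IntermediateField.adjoin.powerBasis`, `Module.Basis.smulTower`).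
-/

set_option linter.dupNamespace false

namespace Summit.Schanuel.Schanuel.Theorems.RootDecomp1EEStableStructure

open IntermediateField

/-- If `β` multiplies each generator into the span, it multiplies the whole span into itself. -/
theorem mul_mem_span_of_gens {n : ℕ} (z : Fin n → ℂ) (β : ℂ)
    (hβ : ∀ i, β * z i ∈ Submodule.span ℚ (Set.range z)) :
    ∀ v ∈ Submodule.span ℚ (Set.range z), β * v ∈ Submodule.span ℚ (Set.range z) := by
  intro v hv
  induction hv using Submodule.span_induction with
  | mem x hx => obtain ⟨i, rfl⟩ := hx; exact hβ i
  | zero => simp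
  | add x y _ _ hx hy => rw [mul_add]; exact Submodule.add_mem _ hx hy
  | smul r x _ hx => rw [mul_smul_comm]; exact Submodule.smul_mem _ r hx

/-- The span is closed under multiplication by every element of `ℚ(β)`. -/
theorem adjoin_mul_mem_span {n : ℕ} (z : Fin n → ℂ) {β : ℂ} (hβ : IsAlgebraic ℚ β)
    (hβV : ∀ i, β * z i ∈ Submodule.span ℚ (Set.range z)) :
    ∀ k ∈ ℚ⟮β⟯, ∀ v ∈ Submodule.span ℚ (Set.range z), k * v ∈ Submodule.span ℚ (Set.range z) := by
  intro k hk
  have hk' : k ∈ Algebra.adjoin ℚ {β} := by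
    rw [← adjoin_simple_toSubalgebra_of_isAlgebraic hβ]; exact hk
  clear hk
  induction hk' using Algebra.adjoin_induction with
  | mem x hx => rw [Set.mem_singleton_iff] at hx; rw [hx]; exact mul_mem_span_of_gens z β hβV
  | algebraMap r => intro v hv; rw [Algebra.algebraMap_eq_smul_one, smul_mul_assoc, one_mul]
                    exact Submodule.smul_mem _ r hv
  | add x y _ _ hx hy => intro v hv; rw [add_mul]; exact Submodule.add_mem _ (hx v hv) (hy v hv)
  | mul x y _ _ hx hy => intro v hv; rw [mul_assoc]; exact hx _ (hy v hv)

/-- The span as a `ℚ(β)`-submodule of `ℂ`. -/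
noncomputable def spanK {n : ℕ} (z : Fin n → ℂ) {β : ℂ} (hβ : IsAlgebraic ℚ β)
    (hβV : ∀ i, β * z i ∈ Submodule.span ℚ (Set.range z)) : Submodule ℚ⟮β⟯ ℂ where
  carrier := Submodule.span ℚ (Set.range z)
  add_mem' := fun ha hb => Submodule.add_mem _ ha hb
  zero_mem' := Submodule.zero_mem _
  smul_mem' := fun k v hv => by
    rw [IntermediateField.smul_def, smul_eq_mul]; exact adjoin_mul_mem_span z hβ hβV k k.2 v hv

/-- Membership in the `ℚ(β)`-span of the tuple. -/
theorem mem_spanK {n : ℕ} (z : Fin n → ℂ) {β : ℂ} (hβ : IsAlgebraic ℚ β)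
    (hβV : ∀ i, β * z i ∈ Submodule.span ℚ (Set.range z)) (v : ℂ) :
    v ∈ spanK z hβ hβV ↔ v ∈ Submodule.span ℚ (Set.range z) := Iff.rfl

/-- ℚ-linear identification of the `ℚ(β)`-submodule with the ℚ-span. -/
noncomputable def spanKEquiv {n : ℕ} (z : Fin n → ℂ) {β : ℂ} (hβ : IsAlgebraic ℚ β)
    (hβV : ∀ i, β * z i ∈ Submodule.span ℚ (Set.range z)) :
    ↥(spanK z hβ hβV) ≃ₗ[ℚ] ↥(Submodule.span ℚ (Set.range z)) where
  toFun v := ⟨v.1, v.2⟩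
  invFun v := ⟨v.1, v.2⟩
  map_add' _ _ := rfl
  map_smul' _ _ := rfl
  left_inv _ := rfl
  right_inv _ := rfl

/-- **Degree divisibility.** If the free span of `z` (length `n`) is stable under an algebraic `β`, then
`deg β ∣ n`; precisely `n = deg β · dim_{ℚ(β)} span`. -/
theorem finrank_eq_degree_mul {n : ℕ} (z : Fin n → ℂ) (hz : LinearIndependent ℚ z) {β : ℂ}
    (hβ : IsAlgebraic ℚ β) (hβV : ∀ i, β * z i ∈ Submodule.span ℚ (Set.range z)) :
    n = (minpoly ℚ β).natDegree * Module.finrank ℚ⟮β⟯ (spanK z hβ hβV) := by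
  rw [← adjoin.finrank hβ.isIntegral, Module.finrank_mul_finrank,
    (spanKEquiv z hβ hβV).finrank_eq, finrank_span_eq_card hz, Fintype.card_fin]

/-- The degree of an algebraic multiplier divides the length of an E-stable ℚ-free tuple. -/
theorem degree_dvd {n : ℕ} (z : Fin n → ℂ) (hz : LinearIndependent ℚ z) {β : ℂ}
    (hβ : IsAlgebraic ℚ β) (hβV : ∀ i, β * z i ∈ Submodule.span ℚ (Set.range z)) :
    (minpoly ℚ β).natDegree ∣ n :=
  Dvd.intro _ (finrank_eq_degree_mul z hz hβ hβV).symm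

/-- **Structure of E-stable spans.**  With `d = deg β` there are `m = n/d` vectors `u_j` in the span such that
`(β^k · u_j)_{k<d, j<m}` is a ℚ-basis of `span_ℚ z`. -/
theorem eStable_structure {n : ℕ} (z : Fin n → ℂ) (hz : LinearIndependent ℚ z) {β : ℂ}
    (hβ : IsAlgebraic ℚ β) (hβV : ∀ i, β * z i ∈ Submodule.span ℚ (Set.range z)) :
    ∃ (m : ℕ) (u : Fin m → ℂ), (minpoly ℚ β).natDegree * m = n ∧
      (∀ j, u j ∈ Submodule.span ℚ (Set.range z)) ∧
      LinearIndependent ℚ (fun p : Fin (minpoly ℚ β).natDegree × Fin m => β ^ (p.1 : ℕ) * u p.2) ∧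
      Submodule.span ℚ (Set.range fun p : Fin (minpoly ℚ β).natDegree × Fin m => β ^ (p.1 : ℕ) * u p.2)
        = Submodule.span ℚ (Set.range z) := by
  set K := ℚ⟮β⟯
  set W := spanK z hβ hβV
  haveI : FiniteDimensional ℚ K := adjoin.finiteDimensional hβ.isIntegral
  -- W is finite over K (it is finite over ℚ)
  haveI : Module.Finite ℚ ↥(Submodule.span ℚ (Set.range z)) := Module.Finite.span_of_finite ℚ (Set.finite_range z)
  haveI : Module.Finite ℚ W := Module.Finite.equiv (spanKEquiv z hβ hβV).symm
  haveI : Module.Finite K W := Module.Finite.of_restrictScalars_finite ℚ K W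
  haveI : Module.Free K W := Module.Free.of_divisionRing K W
  set m := Module.finrank K W
  let bK : Module.Basis (Fin (minpoly ℚ β).natDegree) ℚ K := (adjoin.powerBasis hβ.isIntegral).basis
  let bW : Module.Basis (Fin m) K W := Module.finBasis K W
  let b : Module.Basis (Fin (minpoly ℚ β).natDegree × Fin m) ℚ W := bK.smulTower bW
  have hbK : ∀ k, ((bK k : K) : ℂ) = β ^ (k : ℕ) := fun k => by
    show (((adjoin.powerBasis hβ.isIntegral).basis k : K) : ℂ) = _
    rw [PowerBasis.basis_eq_pow, adjoin.powerBasis_gen]; simp [AdjoinSimple.coe_gen]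
  have hval : ∀ p : Fin (minpoly ℚ β).natDegree × Fin m, ((b p : W) : ℂ) = β ^ (p.1 : ℕ) * bW p.2 := by
    intro p
    rw [Module.Basis.smulTower_apply, Submodule.coe_smul, IntermediateField.smul_def, smul_eq_mul, hbK]
  have hcomp : (⇑(W.subtype.restrictScalars ℚ) ∘ ⇑b) = fun p => β ^ (p.1 : ℕ) * (bW p.2 : ℂ) :=
    funext fun p => by simp [hval p]
  refine ⟨m, fun j => (bW j : ℂ), (finrank_eq_degree_mul z hz hβ hβV).symm, fun j => (bW j).2, ?_, ?_⟩
  · have hli := b.linearIndependent.map' (W.subtype.restrictScalars ℚ)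
      (LinearMap.ker_eq_bot.mpr Subtype.val_injective)
    rw [hcomp] at hli; exact hli
  · apply le_antisymm
    · rw [Submodule.span_le]; rintro _ ⟨p, rfl⟩
      exact adjoin_mul_mem_span z hβ hβV _ (pow_mem (mem_adjoin_simple_self ℚ β) _) _ (bW p.2).2
    · rw [Submodule.span_le]; rintro _ ⟨i, rfl⟩
      have hzW : z i ∈ W := (mem_spanK z hβ hβV _).mpr (Submodule.subset_span ⟨i, rfl⟩)
      have hmem : (W.subtype.restrictScalars ℚ) ⟨z i, hzW⟩ ∈
          Submodule.map (W.subtype.restrictScalars ℚ) (Submodule.span ℚ (Set.range b)) :=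
        Submodule.mem_map_of_mem (b.mem_span _)
      rw [Submodule.map_span, ← Set.range_comp, hcomp] at hmem
      simpa using hmem

/-- Corollary: for PRIME `n` an E-stable free span is an E-LINE `ℚ(β)·λ` with `[ℚ(β):ℚ] = n`. -/
theorem eStable_prime_isLine {n : ℕ} (hn : n.Prime) (z : Fin n → ℂ) (hz : LinearIndependent ℚ z) {β : ℂ}
    (hβ : IsAlgebraic ℚ β) (hβirr : β ∉ Set.range (algebraMap ℚ ℂ))
    (hβV : ∀ i, β * z i ∈ Submodule.span ℚ (Set.range z)) :
    (minpoly ℚ β).natDegree = n ∧ ∃ lam : ℂ, lam ∈ Submodule.span ℚ (Set.range z) ∧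
      LinearIndependent ℚ (fun k : Fin n => β ^ (k : ℕ) * lam) ∧
      Submodule.span ℚ (Set.range fun k : Fin n => β ^ (k : ℕ) * lam) = Submodule.span ℚ (Set.range z) := by
  obtain ⟨m, u, hmn, hu, hli, hspan⟩ := eStable_structure z hz hβ hβV
  have hd2 : 2 ≤ (minpoly ℚ β).natDegree := by
    rw [minpoly.two_le_natDegree_iff hβ.isIntegral]
    intro h; exact hβirr (by rwa [RingHom.mem_range, ← Set.mem_range] at h)
  have hdn : (minpoly ℚ β).natDegree = n := by
    rcases hn.eq_one_or_self_of_dvd _ (Dvd.intro _ hmn) with h | h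
    · omega
    · exact h
  have hm : m = 1 := by
    rcases Nat.lt_or_ge m 1 with h | h
    · interval_cases m; simp at hmn; exact absurd hmn.symm hn.ne_zero
    · by_contra h1
      have : 2 ≤ m := by omega
      nlinarith [hn.two_le]
  subst hm
  refine ⟨hdn, u 0, hu 0, ?_, ?_⟩
  · let e : Fin n ≃ Fin (minpoly ℚ β).natDegree × Fin 1 :=
      (finCongr hdn.symm).trans (Equiv.prodUnique (Fin (minpoly ℚ β).natDegree) (Fin 1)).symm
    have hcomp : (fun p : Fin (minpoly ℚ β).natDegree × Fin 1 => β ^ (p.1 : ℕ) * u p.2) ∘ e =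
        fun k : Fin n => β ^ (k : ℕ) * u 0 := by
      funext k; simp [e, Fin.default_eq_zero]
    rw [← hcomp]; exact hli.comp e e.injective
  · rw [← hspan]
    let e : Fin n ≃ Fin (minpoly ℚ β).natDegree × Fin 1 :=
      (finCongr hdn.symm).trans (Equiv.prodUnique (Fin (minpoly ℚ β).natDegree) (Fin 1)).symm
    have hcomp : (fun p : Fin (minpoly ℚ β).natDegree × Fin 1 => β ^ (p.1 : ℕ) * u p.2) ∘ e =
        fun k : Fin n => β ^ (k : ℕ) * u 0 := by
      funext k; simp [e, Fin.default_eq_zero]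
    rw [← hcomp, e.surjective.range_comp]

end Summit.Schanuel.Schanuel.Theorems.RootDecomp1EEStableStructure
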